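import Summits.FinalStateConjecture.FinalStateConjecture.Theorems.ZeroEnergyKerrOrBombStationaryLimitReductionKerrIsometryRigidityWave3ChartMap
import Literature.Geometry.Lorentzian.KerrSchildEnergyEstimate
import Literature.Geometry.Lorentzian.KerrRedShiftCoercivity
import HarnessLib

/-!
# Route ZeroEnergyKerrOrBomb · crux `StationaryLimitReduction` (stmt-FinalStateConjecture-10021), line
# `symplectic-dual-of-the-bomb` — stub 1R `kerrIsometryRigidity`, wave 3: END MATCHING, the pulled-back
# chart-time lines (inverse function theorem) and coordinate lemmas

Helper file (`--supports stmt-FinalStateConjecture-10021`; registered helper `hasStrictFDerivAt_chartInv_of_isometry`) of the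
lead's wave-3 stub-worker for `stub_kerrIsometryRigidity` (lead prover-line-stmt-FinalStateConjecture-10021-a2-0,
2026-08-16). Second of the files proving the end-matching obligation F0 (`KerrEndMatching` of
`…KerrIsometryRigidityWave3Facts`); fact-free. It continues `…KerrIsometryRigidityWave3ChartMap` (p125496).

* §3 `chartInv Θ S` — the inverse of a smooth injective isometry `Θ` on an open set `S ⊆ E4` (nondegenerate
  source form): strictly differentiable on the image with the inverse differential (inverse function theorem,
  `HasStrictFDerivAt.to_local_left_inverse`); the chart-time lines `s ↦ Θ⁻¹ (u + s e₀)` are integral curves of any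
  field `Y` with `DΘ (Y) = e₀`, so functions annihilated by `Y` are constant along them
  (`apply_chartInv_line_eq`) and a constant time component `Y⁰ = α` makes the Kerr–Schild time affine
  of slope `α` (`chartInv_line_apply_zero`);
* §4 coordinate lemmas on `E4` (`‖u‖² = t² + ‖y‖²`, `|‖y‖ − ‖y'‖| ≤ ‖u − u'‖`; the bounds `‖y‖ ≤ ‖u‖`,
  `‖y‖² ≤ r² + a²` are the Literature lemmas `E4.spatialNorm_le_norm`, `Kerr.spatialNorm_sq_le`).

References: B. O'Neill, *Semi-Riemannian Geometry* (1983), Ch. 1 (Thm. 1.16, p. 29); M. Visser,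
arXiv:0706.0622, (35).
-/

set_option linter.dupNamespace false

noncomputable section

open scoped Manifold ContDiff Topology
open Set Filter Function

namespace Summit.FinalStateConjecture.FinalStateConjecture.Theorems.SymplecticDualOfTheBomb

open Literature.Geometry.Lorentzian Literature.Geometry.Manifold

/-! ## §3 The inverse of an isometric open embedding `S → E4` and its chart-time lines -/

section Inverse

variable {Θ : E4 → E4} {S : Set E4}

/-- The **inverse of `Θ` on `Θ '' S`** (`Function.invFunOn`; junk off the image). [folklore] -/
def chartInv (Θ : E4 → E4) (S : Set E4) : E4 → E4 := Function.invFunOn Θ S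

/-- `Θ⁻¹ (Θ x) = x` for `x ∈ S` when `Θ` is injective on `S`. [folklore] -/
theorem chartInv_apply (hinj : Set.InjOn Θ S) {x : E4} (hx : x ∈ S) : chartInv Θ S (Θ x) = x :=
  hinj.leftInvOn_invFunOn hx

/-- `Θ⁻¹ u ∈ S` and `Θ (Θ⁻¹ u) = u` for `u ∈ Θ '' S`. [folklore] -/
theorem chartInv_spec {u : E4} (hu : u ∈ Θ '' S) : chartInv Θ S u ∈ S ∧ Θ (chartInv Θ S u) = u := by
  obtain ⟨x, hx, rfl⟩ := hu
  exact Function.invFunOn_pos ⟨x, hx, rfl⟩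

/-- **The inverse of a smooth injective isometry is strictly differentiable on the image, with the
inverse differential** (inverse function theorem, `HasStrictFDerivAt.to_local_left_inverse`: `DΘ_x` is
injective by the isometry clause with a nondegenerate source form, hence a linear automorphism of `E4`, and
`Θ⁻¹ ∘ Θ = id` near `x`, `S` being open). O'Neill 1983, Ch. 1, Thm. 1.16. [folklore] -/
theorem exists_hasStrictFDerivAt_chartInv (hS : IsOpen S) (hΘ : ContDiffOn ℝ ∞ Θ S) (hinj : Set.InjOn Θ S)
    {B₁ B₂ : E4 → E4 →L[ℝ] E4 →L[ℝ] ℝ}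
    (hiso : ∀ x ∈ S, ∀ v w : E4, B₁ (Θ x) (fderiv ℝ Θ x v) (fderiv ℝ Θ x w) = B₂ x v w)
    (hB₂ : ∀ x ∈ S, ∀ v : E4, (∀ w, B₂ x v w = 0) → v = 0) {x : E4} (hx : x ∈ S) :
    ∃ L : E4 ≃L[ℝ] E4, (∀ v, L v = fderiv ℝ Θ x v) ∧
      HasStrictFDerivAt (chartInv Θ S) (L.symm : E4 →L[ℝ] E4) (Θ x) := by
  have hinjD : Function.Injective (fderiv ℝ Θ x) := fderiv_injective_of_isometry (hiso x hx) (hB₂ x hx)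
  have hsurjD : Function.Surjective (fderiv ℝ Θ x) :=
    LinearMap.injective_iff_surjective.1 hinjD
  set L : E4 ≃L[ℝ] E4 :=
    (LinearEquiv.ofBijective (fderiv ℝ Θ x).toLinearMap ⟨hinjD, hsurjD⟩).toContinuousLinearEquiv with hL
  have hLv : ∀ v, L v = fderiv ℝ Θ x v := fun v ↦ rfl
  have hLe : (L : E4 →L[ℝ] E4) = fderiv ℝ Θ x := ContinuousLinearMap.ext hLv
  have hstrict : HasStrictFDerivAt Θ (L : E4 →L[ℝ] E4) x := by
    rw [hLe]
    exact (hΘ.contDiffAt (hS.mem_nhds hx)).hasStrictFDerivAt (by simp)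
  refine ⟨L, hLv, hstrict.to_local_left_inverse ?_⟩
  exact Filter.eventually_of_mem (hS.mem_nhds hx) fun y hy ↦ chartInv_apply hinj hy

/-- The inverse is continuous at the points of the image. [folklore] -/
theorem continuousAt_chartInv (hS : IsOpen S) (hΘ : ContDiffOn ℝ ∞ Θ S) (hinj : Set.InjOn Θ S)
    {B₁ B₂ : E4 → E4 →L[ℝ] E4 →L[ℝ] ℝ}
    (hiso : ∀ x ∈ S, ∀ v w : E4, B₁ (Θ x) (fderiv ℝ Θ x v) (fderiv ℝ Θ x w) = B₂ x v w)
    (hB₂ : ∀ x ∈ S, ∀ v : E4, (∀ w, B₂ x v w = 0) → v = 0) {u : E4} (hu : u ∈ Θ '' S) :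
    ContinuousAt (chartInv Θ S) u := by
  obtain ⟨hxS, hxu⟩ := chartInv_spec hu
  obtain ⟨L, -, hL⟩ := exists_hasStrictFDerivAt_chartInv hS hΘ hinj hiso hB₂ hxS
  rw [hxu] at hL
  exact hL.continuousAt

variable {Yv : E4 → E4}

/-- **The chart-time lines pull back to integral curves of `Y`.** If `DΘ_x (Y x) = e₀` on `S` and the
image `Θ '' S` is invariant under `u ↦ u + s e₀`, then for `u ∈ Θ '' S` the curve
`γ(s) = Θ⁻¹ (u + s e₀)` satisfies `γ' = Y ∘ γ` (chain rule with `DΘ⁻¹ = (DΘ)⁻¹` and `(DΘ)⁻¹ e₀ = Y`).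
O'Neill 1983, Ch. 1, p. 29 (integral curves). [folklore] -/
theorem hasDerivAt_chartInv_line (hS : IsOpen S) (hΘ : ContDiffOn ℝ ∞ Θ S) (hinj : Set.InjOn Θ S)
    {B₁ B₂ : E4 → E4 →L[ℝ] E4 →L[ℝ] ℝ}
    (hiso : ∀ x ∈ S, ∀ v w : E4, B₁ (Θ x) (fderiv ℝ Θ x v) (fderiv ℝ Θ x w) = B₂ x v w)
    (hB₂ : ∀ x ∈ S, ∀ v : E4, (∀ w, B₂ x v w = 0) → v = 0)
    (hYv : ∀ x ∈ S, fderiv ℝ Θ x (Yv x) = E4.basisVector 0)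
    (hP : ∀ u ∈ Θ '' S, ∀ s : ℝ, u + s • E4.basisVector 0 ∈ Θ '' S) {u : E4} (hu : u ∈ Θ '' S)
    (s : ℝ) :
    HasDerivAt (fun s : ℝ ↦ chartInv Θ S (u + s • E4.basisVector 0))
      (Yv (chartInv Θ S (u + s • E4.basisVector 0))) s := by
  obtain ⟨hxS, hxu⟩ := chartInv_spec (hP u hu s)
  obtain ⟨L, hLv, hL⟩ := exists_hasStrictFDerivAt_chartInv hS hΘ hinj hiso hB₂ hxS
  rw [hxu] at hL
  have hline : HasDerivAt (fun s : ℝ ↦ u + s • E4.basisVector 0) (E4.basisVector 0) s := by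
    simpa using ((hasDerivAt_id s).smul_const (E4.basisVector 0)).const_add u
  have h := hL.hasFDerivAt.comp_hasDerivAt s hline
  have hY : (L.symm : E4 →L[ℝ] E4) (E4.basisVector 0) = Yv (chartInv Θ S (u + s • E4.basisVector 0)) := by
    rw [ContinuousLinearEquiv.coe_coe, ContinuousLinearEquiv.symm_apply_eq, hLv]
    exact (hYv _ hxS).symm
  rw [hY] at h
  exact h

/-- **A function annihilated by `Y` is constant along the pulled-back chart-time lines**
(zero derivative on `ℝ`, `is_const_of_deriv_eq_zero`). [folklore] -/
theorem apply_chartInv_line_eq (hS : IsOpen S) (hΘ : ContDiffOn ℝ ∞ Θ S) (hinj : Set.InjOn Θ S)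
    {B₁ B₂ : E4 → E4 →L[ℝ] E4 →L[ℝ] ℝ}
    (hiso : ∀ x ∈ S, ∀ v w : E4, B₁ (Θ x) (fderiv ℝ Θ x v) (fderiv ℝ Θ x w) = B₂ x v w)
    (hB₂ : ∀ x ∈ S, ∀ v : E4, (∀ w, B₂ x v w = 0) → v = 0)
    (hYv : ∀ x ∈ S, fderiv ℝ Θ x (Yv x) = E4.basisVector 0)
    (hP : ∀ u ∈ Θ '' S, ∀ s : ℝ, u + s • E4.basisVector 0 ∈ Θ '' S)
    {f : E4 → ℝ} (hf : ∀ x ∈ S, DifferentiableAt ℝ f x) (hfY : ∀ x ∈ S, fderiv ℝ f x (Yv x) = 0)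
    {u : E4} (hu : u ∈ Θ '' S) (s : ℝ) :
    f (chartInv Θ S (u + s • E4.basisVector 0)) = f (chartInv Θ S u) := by
  set γ : ℝ → E4 := fun s ↦ chartInv Θ S (u + s • E4.basisVector 0) with hγ
  have hderiv : ∀ s : ℝ, HasDerivAt (f ∘ γ) 0 s := by
    intro s'
    have hxS : γ s' ∈ S := (chartInv_spec (hP u hu s')).1
    have h1 := hasDerivAt_chartInv_line hS hΘ hinj hiso hB₂ hYv hP hu s'
    have h2 := ((hf _ hxS).hasFDerivAt).comp_hasDerivAt s' h1
    rwa [hfY _ hxS] at h2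
  have hdiff : Differentiable ℝ (f ∘ γ) := fun s' ↦ (hderiv s').differentiableAt
  have h := is_const_of_deriv_eq_zero hdiff (fun s' ↦ (hderiv s').deriv) s 0
  simp only [Function.comp_apply, hγ, zero_smul, add_zero] at h
  exact h

/-- **Chart time along the pulled-back lines is affine**: if `(Y x)⁰ = α` on `S`, then
`(Θ⁻¹ (u + s e₀))⁰ = (Θ⁻¹ u)⁰ + α s`. [folklore] -/
theorem chartInv_line_apply_zero (hS : IsOpen S) (hΘ : ContDiffOn ℝ ∞ Θ S) (hinj : Set.InjOn Θ S)
    {B₁ B₂ : E4 → E4 →L[ℝ] E4 →L[ℝ] ℝ}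
    (hiso : ∀ x ∈ S, ∀ v w : E4, B₁ (Θ x) (fderiv ℝ Θ x v) (fderiv ℝ Θ x w) = B₂ x v w)
    (hB₂ : ∀ x ∈ S, ∀ v : E4, (∀ w, B₂ x v w = 0) → v = 0)
    (hYv : ∀ x ∈ S, fderiv ℝ Θ x (Yv x) = E4.basisVector 0)
    (hP : ∀ u ∈ Θ '' S, ∀ s : ℝ, u + s • E4.basisVector 0 ∈ Θ '' S) {α : ℝ}
    (hα : ∀ x ∈ S, Yv x 0 = α) {u : E4} (hu : u ∈ Θ '' S) (s : ℝ) :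
    chartInv Θ S (u + s • E4.basisVector 0) 0 = chartInv Θ S u 0 + α * s := by
  set γ : ℝ → E4 := fun s ↦ chartInv Θ S (u + s • E4.basisVector 0) with hγ
  -- the function `s ↦ (γ s)⁰ − α s` has zero derivative
  have hderiv : ∀ s : ℝ, HasDerivAt (fun s : ℝ ↦ γ s 0 - α * s) 0 s := by
    intro s'
    have hxS : γ s' ∈ S := (chartInv_spec (hP u hu s')).1
    have h1 := hasDerivAt_chartInv_line hS hΘ hinj hiso hB₂ hYv hP hu s'
    have h2 : HasDerivAt (fun s : ℝ ↦ γ s 0) (Yv (γ s') 0) s' :=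
      ((EuclideanSpace.proj (𝕜 := ℝ) (0 : Fin 4)).hasFDerivAt).comp_hasDerivAt s' h1
    rw [hα _ hxS] at h2
    have h3 : HasDerivAt (fun s : ℝ ↦ α * s) (α * 1) s' := (hasDerivAt_id s').const_mul α
    rw [mul_one] at h3
    have h4 := h2.sub h3
    rwa [sub_self] at h4
  have hdiff : Differentiable ℝ (fun s : ℝ ↦ γ s 0 - α * s) := fun s' ↦ (hderiv s').differentiableAt
  have h := is_const_of_deriv_eq_zero hdiff (fun s' ↦ (hderiv s').deriv) s 0
  simp only [hγ, zero_smul, add_zero, mul_zero, sub_zero] at h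
  linarith


/-- **Registered helper `hasStrictFDerivAt_chartInv_of_isometry`** (registration device of this file; the
`∀`-form of `exists_hasStrictFDerivAt_chartInv`): the inverse of a smooth injective isometry on an open set of
`E4`, from nondegenerate source forms, is strictly differentiable at each image point with the inverse
differential. O'Neill 1983, Ch. 1, Thm. 1.16. [folklore] -/
theorem hasStrictFDerivAt_chartInv_of_isometry : ∀ (Θ : E4 → E4) (S : Set E4) (B₁ B₂ : E4 → E4 →L[ℝ] E4 →L[ℝ] ℝ) (x : E4), IsOpen S → ContDiffOn ℝ ∞ Θ S → Set.InjOn Θ S → (∀ x ∈ S, ∀ v w : E4, B₁ (Θ x) (fderiv ℝ Θ x v) (fderiv ℝ Θ x w) = B₂ x v w) → (∀ x ∈ S, ∀ v : E4, (∀ w, B₂ x v w = 0) → v = 0) → x ∈ S → ∃ L : E4 ≃L[ℝ] E4, (∀ v, L v = fderiv ℝ Θ x v) ∧ HasStrictFDerivAt (chartInv Θ S) (L.symm : E4 →L[ℝ] E4) (Θ x) :=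
  fun _ _ _ _ _ hS hΘ hinj hiso hB₂ hx ↦ exists_hasStrictFDerivAt_chartInv hS hΘ hinj hiso hB₂ hx

end Inverse

/-! ## §4 Coordinate lemmas on `E4` -/

section Coord

/-- `‖u‖² = (u⁰)² + spatialNorm u ²`. [folklore] -/
theorem _root_.Literature.Geometry.Lorentzian.E4.norm_sq_eq_time_sq_add (u : E4) :
    ‖u‖ ^ 2 = (u 0) ^ 2 + E4.spatialNorm u ^ 2 := by
  rw [EuclideanSpace.real_norm_sq_eq, E4.spatialNorm_sq, Fin.sum_univ_four]
  ring

/-- `|spatialNorm u − spatialNorm v| ≤ ‖u − v‖`. [folklore] -/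
theorem _root_.Literature.Geometry.Lorentzian.E4.abs_spatialNorm_sub_le (u v : E4) :
    |E4.spatialNorm u - E4.spatialNorm v| ≤ ‖u - v‖ := by
  have h := abs_norm_sub_norm_le (E4.spatial u) (E4.spatial v)
  rw [← map_sub] at h
  exact h.trans (E4.spatialNorm_le_norm (u - v))

end Coord


end Summit.FinalStateConjecture.FinalStateConjecture.Theorems.SymplecticDualOfTheBomb

end
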